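import Literature.Computability.Cryptography.WordRAMExec
import HarnessLib

/-!
# The word RAM — code blocks: straight-line segments and counting loops

Compositional reasoning about word-RAM programs (`Literature.Computability.Cryptography.WordRAM`,
execution calculus `…WordRAMExec`): a program is a flat instruction list with absolute jump
targets, so specifications are stated for a *block placed at an offset* and hold in every
program containing the block there.

* `CodeAt P i₀ B`: the instructions of `B` occupy positions `i₀, i₀ + 1, …` of `P`
  (`codeAt_append_iff`, `codeAt_of_eq_append`, `CodeAt.getElem?_zero`);
* straight-line arithmetic: `OpSpec = BinOp × Operand × Operand × Operand`, its instruction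
  `OpSpec.toInstr`, its memory effect `execOp` / `execOps` (a left fold), and `run_ops`: a block of
  `k` operations placed at the program counter executes in exactly `k` steps, leaving
  `pc = i₀ + k`, memory `execOps w mem ops`, coins and query log unchanged;
* counting loops: `loopBlock i₀ RC body = [jz (dir RC) exit] ++ body ++ [jmp i₀]` with
  `exit = i₀ + |body| + 2`, and `run_loop`: if an invariant `Inv m mem` (indexed by the value `m`
  of the counter cell `RC`) is preserved by the body while decreasing the counter by one, then from
  `pc = i₀` with `Inv m mem` the block reaches `pc = exit` after exactly `m * (|body| + 2) + 1`
  steps with memory `(execOps w · body)^[m] mem`;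
* a first verified loop, `zeroLoop i₀ RC RP`: zero the `m` cells starting at the address held in
  `RP` (`run_zeroLoop`: `5 m + 1` steps; cells `[p, p + m)` become `0`, `RC` becomes `0`, `RP`
  becomes `p + m`, everything else is unchanged), the clean-up primitive of inline oracle
  simulations (VVW ICM 2018, Prop. 2.1) — under the side conditions that the two registers lie
  outside the segment and that `p + m < 2 ^ w` (pointer arithmetic does not wrap).

## References

* T. Hagerup, *Sorting and searching on the word RAM*, STACS 1998, §2.
* V. Vassilevska Williams, *On some fine-grained questions in algorithms and complexity*,
  Proc. ICM 2018, §2.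
-/

namespace Literature.Computability.Cryptography.WordRAM

open StateTransition

/-! ## Blocks at an offset -/

/-- `CodeAt P i₀ B`: the block `B` occupies positions `i₀, …, i₀ + |B| - 1` of program `P`. [folklore] -/
def CodeAt (P : Program) (i₀ : ℕ) (B : List Instr) : Prop :=
  ∀ j : ℕ, ∀ I : Instr, B[j]? = some I → P[i₀ + j]? = some I

/-- The empty block is everywhere. [folklore] -/
theorem codeAt_nil (P : Program) (i₀ : ℕ) : CodeAt P i₀ [] := fun j I h => by simp at h

/-- A block at an offset, split at a cons. [folklore] -/
theorem codeAt_cons_iff {P : Program} {i₀ : ℕ} {I : Instr} {B : List Instr} :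
    CodeAt P i₀ (I :: B) ↔ P[i₀]? = some I ∧ CodeAt P (i₀ + 1) B := by
  constructor
  · intro h
    refine ⟨by simpa using h 0 I (by simp), fun j J hj => ?_⟩
    have := h (j + 1) J (by simpa using hj)
    simpa [Nat.add_assoc, Nat.add_comm 1 j] using this
  · rintro ⟨h0, h⟩ j J hj
    cases j with
    | zero => simp only [List.getElem?_cons_zero, Option.some.injEq] at hj; subst hj; simpa using h0
    | succ j =>
      have := h j J (by simpa using hj)
      simpa [Nat.add_assoc, Nat.add_comm 1 j] using this

/-- A block at an offset, split at an append. [folklore] -/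
theorem codeAt_append_iff {P : Program} {i₀ : ℕ} {B₁ B₂ : List Instr} :
    CodeAt P i₀ (B₁ ++ B₂) ↔ CodeAt P i₀ B₁ ∧ CodeAt P (i₀ + B₁.length) B₂ := by
  induction B₁ generalizing i₀ with
  | nil => simp [codeAt_nil]
  | cons I B₁ ih =>
    rw [List.cons_append, codeAt_cons_iff, codeAt_cons_iff, ih, and_assoc]
    simp [Nat.add_assoc, Nat.add_comm 1]

/-- The first instruction of a nonempty block. [folklore] -/
theorem CodeAt.getElem?_zero {P : Program} {i₀ : ℕ} {I : Instr} {B : List Instr}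
    (h : CodeAt P i₀ (I :: B)) : P[i₀]? = some I :=
  (codeAt_cons_iff.1 h).1

/-- The tail of a block sits one position further. [folklore] -/
theorem CodeAt.tail {P : Program} {i₀ : ℕ} {I : Instr} {B : List Instr}
    (h : CodeAt P i₀ (I :: B)) : CodeAt P (i₀ + 1) B :=
  (codeAt_cons_iff.1 h).2

/-- A program of the form `pre ++ B ++ post` has `B` at offset `|pre|`. [folklore] -/
theorem codeAt_of_eq_append {P : Program} {pre B post : List Instr} (h : P = pre ++ B ++ post) :
    CodeAt P pre.length B := by
  subst h
  intro j I hj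
  have hjl : j < B.length := (List.getElem?_eq_some_iff.1 hj).1
  rw [List.append_assoc, List.getElem?_append_right (Nat.le_add_right _ _), Nat.add_sub_cancel_left,
    List.getElem?_append_left hjl, hj]

/-- A whole program is a block at offset `0` of itself. [folklore] -/
theorem codeAt_self (P : Program) : CodeAt P 0 P := fun j I hj => by simpa using hj

/-! ## Straight-line arithmetic -/

/-- The data of a three-address operation `dst := o x y`. [folklore] -/
abbrev OpSpec : Type := BinOp × Operand × Operand × Operand

/-- The instruction of an operation. [folklore] -/
def OpSpec.toInstr (s : OpSpec) : Instr :=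
  .op s.1 s.2.1 s.2.2.1 s.2.2.2

/-- The memory effect of one operation at word size `w` (as in `WordRAM.step`). [folklore] -/
def execOp (w : ℕ) (mem : ℕ → ℕ) (s : OpSpec) : ℕ → ℕ :=
  s.2.1.write mem (s.1.eval w (s.2.2.1.read mem) (s.2.2.2.read mem))

/-- The memory effect of a straight-line list of operations (executed left to right). [folklore] -/
def execOps (w : ℕ) (mem : ℕ → ℕ) (ops : List OpSpec) : ℕ → ℕ :=
  ops.foldl (execOp w) mem

/-- No operations: no effect. [folklore] -/
@[simp] theorem execOps_nil (w : ℕ) (mem : ℕ → ℕ) : execOps w mem [] = mem := rfl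

/-- Unfolding one operation. [folklore] -/
@[simp] theorem execOps_cons (w : ℕ) (mem : ℕ → ℕ) (s : OpSpec) (ops : List OpSpec) :
    execOps w mem (s :: ops) = execOps w (execOp w mem s) ops := rfl

/-- Effects compose along appends. [folklore] -/
theorem execOps_append (w : ℕ) (mem : ℕ → ℕ) (ops₁ ops₂ : List OpSpec) :
    execOps w mem (ops₁ ++ ops₂) = execOps w (execOps w mem ops₁) ops₂ := by
  simp [execOps, List.foldl_append]

/-- **Straight-line execution.** A block of operations placed at the program counter executes in
exactly as many steps as it has instructions, leaving the program counter right after the block,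
the memory transformed by `execOps`, and coins and query log unchanged. [folklore] -/
theorem run_ops {P : Program} {w : ℕ} {O : List ℕ → List ℕ} {ρ : ℕ → ℕ} :
    ∀ (ops : List OpSpec) {i₀ : ℕ} {c : Cfg}, CodeAt P i₀ (ops.map OpSpec.toInstr) →
      c.pc = some i₀ →
      run P w O ρ ops.length c =
        some { c with pc := some (i₀ + ops.length), mem := execOps w c.mem ops }
  | [], i₀, c, _, hpc => by
      cases c; simp only [List.length_nil, run_zero, Nat.add_zero, execOps_nil, Option.some.injEq]
      simp only at hpc; subst hpc; rfl
  | s :: ops, i₀, c, hcode, hpc => by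
      rw [List.map_cons] at hcode
      have h1 : step P w O ρ c = some { c with pc := some (i₀ + 1), mem := execOp w c.mem s } :=
        step_op hpc hcode.getElem?_zero
      rw [List.length_cons, run_succ_of_step _ _ _ _ h1,
        run_ops ops (hcode.tail) rfl]
      simp only [execOps_cons, Option.some.injEq]
      congr 2
      omega

/-! ## Counting loops -/

/-- The counting-loop block at offset `i₀` with counter cell `RC` and straight-line body `body`:
`jz (dir RC) exit; body; jmp i₀`, where `exit = i₀ + |body| + 2` is the position right after
the block. [folklore] -/
def loopBlock (i₀ RC : ℕ) (body : List OpSpec) : List Instr :=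
  [.jz (.dir RC) (i₀ + body.length + 2)] ++ body.map OpSpec.toInstr ++ [.jmp i₀]

/-- The length of a loop block. [folklore] -/
@[simp] theorem loopBlock_length (i₀ RC : ℕ) (body : List OpSpec) :
    (loopBlock i₀ RC body).length = body.length + 2 := by
  simp [loopBlock]

/-- **Counting-loop execution.** Let `Inv m mem` be an invariant indexed by the counter value
(`Inv m mem → mem RC = m`) which the body preserves while decrementing the counter
(`Inv (m+1) mem → Inv m (execOps w mem body)`). Then from `pc = i₀` and a memory satisfying
`Inv m`, the loop block reaches `pc = i₀ + |body| + 2` after exactly `m * (|body| + 2) + 1` steps,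
with memory `(execOps w · body)^[m] mem` (which satisfies `Inv 0`), coins and query log
unchanged. [folklore] -/
theorem run_loop {P : Program} {w : ℕ} {O : List ℕ → List ℕ} {ρ : ℕ → ℕ} {i₀ RC : ℕ}
    {body : List OpSpec} {Inv : ℕ → (ℕ → ℕ) → Prop}
    (hRC : ∀ m mem, Inv m mem → mem RC = m)
    (hbody : ∀ m mem, Inv (m + 1) mem → Inv m (execOps w mem body))
    (hcode : CodeAt P i₀ (loopBlock i₀ RC body)) :
    ∀ (m : ℕ) {c : Cfg}, c.pc = some i₀ → Inv m c.mem →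
      run P w O ρ (m * (body.length + 2) + 1) c =
        some { c with pc := some (i₀ + body.length + 2),
                      mem := (fun mem => execOps w mem body)^[m] c.mem } := by
  have hjz : P[i₀]? = some (.jz (.dir RC) (i₀ + body.length + 2)) :=
    (codeAt_append_iff.1 (codeAt_append_iff.1 hcode).1).1.getElem?_zero
  have hops : CodeAt P (i₀ + 1) (body.map OpSpec.toInstr) := by
    have := (codeAt_append_iff.1 (codeAt_append_iff.1 hcode).1).2
    simpa using this
  have hjmp : P[i₀ + 1 + body.length]? = some (.jmp i₀) := by
    have := (codeAt_append_iff.1 hcode).2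
    simp only [List.length_append, List.length_cons, List.length_nil, List.length_map] at this
    have h := this.getElem?_zero
    simpa [Nat.add_assoc, Nat.add_comm, Nat.add_left_comm] using h
  intro m
  induction m with
  | zero =>
    intro c hpc hInv
    have h0 : (Operand.dir RC).read c.mem = 0 := by simpa using hRC 0 _ hInv
    rw [Nat.zero_mul, Nat.zero_add, run_one, step_jz_zero hpc hjz h0]
    simp
  | succ m ih =>
    intro c hpc hInv
    have hne : (Operand.dir RC).read c.mem ≠ 0 := by
      simp only [Operand.read_dir, hRC (m + 1) _ hInv]; omega
    set mem₁ : ℕ → ℕ := execOps w c.mem body with hmem₁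
    -- 1 step: the test falls through
    have h1 : step P w O ρ c = some { c with pc := some (i₀ + 1) } := step_jz_ne hpc hjz hne
    -- |body| steps: the body
    have h2 := run_ops (P := P) (w := w) (O := O) (ρ := ρ) body hops
      (c := { c with pc := some (i₀ + 1) }) rfl
    -- 1 step: jump back
    have h3 : step P w O ρ { c with pc := some (i₀ + 1 + body.length), mem := mem₁ } =
        some { c with pc := some i₀, mem := mem₁ } :=
      step_jmp rfl hjmp
    have h4 := ih (c := { c with pc := some i₀, mem := mem₁ }) rfl (hbody m _ hInv)
    have hsteps : (m + 1) * (body.length + 2) + 1 =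
        ((body.length + 1) + (m * (body.length + 2) + 1)) + 1 := by
      rw [Nat.succ_mul]; omega
    rw [hsteps, run_succ_of_step _ _ _ _ h1,
      run_add_of_run _ _ _ _ (run_add_of_run _ _ _ _ h2 (by rw [run_one, h3])) h4,
      Function.iterate_succ_apply]

/-- The invariant survives the loop: `Inv 0` holds for the final memory. [folklore] -/
theorem loop_inv_iterate {w : ℕ} {body : List OpSpec} {Inv : ℕ → (ℕ → ℕ) → Prop}
    (hbody : ∀ m mem, Inv (m + 1) mem → Inv m (execOps w mem body)) :
    ∀ (m : ℕ) (mem : ℕ → ℕ), Inv m mem → Inv 0 ((fun mem => execOps w mem body)^[m] mem)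
  | 0, _, h => h
  | m + 1, mem, h => by
      rw [Function.iterate_succ_apply]
      exact loop_inv_iterate hbody m _ (hbody m mem h)

/-! ## A first verified loop: zeroing a segment -/

/-- The body of the zeroing loop: `mem[mem RP] := 0; RP += 1; RC -= 1`. [folklore] -/
def zeroBody (RC RP : ℕ) : List OpSpec :=
  [(.add, .ind RP, .imm 0, .imm 0), (.add, .dir RP, .dir RP, .imm 1), (.sub, .dir RC, .dir RC, .imm 1)]

/-- The zeroing loop at offset `i₀`: while `RC ≠ 0`: `mem[mem RP] := 0; RP += 1; RC -= 1`.
Five instructions; exit at `i₀ + 5`. [folklore] -/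
def zeroLoop (i₀ RC RP : ℕ) : List Instr :=
  loopBlock i₀ RC (zeroBody RC RP)

/-- The zeroing loop has five instructions. [folklore] -/
@[simp] theorem zeroLoop_length (i₀ RC RP : ℕ) : (zeroLoop i₀ RC RP).length = 5 := by
  simp [zeroLoop, zeroBody]

/-- The memory after `j` rounds of the zeroing loop started with counter `m` and pointer `p`:
`RC = m - j`, `RP = p + j`, cells `[p, p + j)` are `0`, all other cells unchanged. [folklore] -/
def zeroLoopMem (RC RP p m j : ℕ) (mem : ℕ → ℕ) : ℕ → ℕ :=
  fun a => if a = RC then m - j else if a = RP then p + j else if p ≤ a ∧ a < p + j then 0 else mem a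

/-- The intended final memory of the zeroing loop started with counter `m` and pointer `p`:
cells `[p, p + m)` are `0`, `RC = 0`, `RP = p + m`, all other cells unchanged. [folklore] -/
def zeroLoopResult (RC RP p m : ℕ) (mem : ℕ → ℕ) : ℕ → ℕ :=
  zeroLoopMem RC RP p m m mem

/-- Cells outside the segment and the two registers are unchanged by the zeroing loop. [folklore] -/
theorem zeroLoopResult_apply_of_ne {RC RP p m : ℕ} {mem : ℕ → ℕ} {a : ℕ} (hC : a ≠ RC)
    (hP : a ≠ RP) (ha : a < p ∨ p + m ≤ a) : zeroLoopResult RC RP p m mem a = mem a := by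
  simp only [zeroLoopResult, zeroLoopMem, if_neg hC, if_neg hP]
  rw [if_neg]
  omega

/-- Cells inside the segment are zeroed. [folklore] -/
theorem zeroLoopResult_apply_of_mem {RC RP p m : ℕ} {mem : ℕ → ℕ} {a : ℕ} (hC : a ≠ RC)
    (hP : a ≠ RP) (ha : p ≤ a ∧ a < p + m) : zeroLoopResult RC RP p m mem a = 0 := by
  simp only [zeroLoopResult, zeroLoopMem, if_neg hC, if_neg hP, Nat.sub_self]
  rw [if_pos ha]

/-- After the loop the counter is `0`. [folklore] -/
@[simp] theorem zeroLoopResult_apply_counter (RC RP p m : ℕ) (mem : ℕ → ℕ) :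
    zeroLoopResult RC RP p m mem RC = 0 := by
  simp [zeroLoopResult, zeroLoopMem]

/-- After the loop the pointer is `p + m`. [folklore] -/
theorem zeroLoopResult_apply_pointer {RC RP : ℕ} (hne : RC ≠ RP) (p m : ℕ) (mem : ℕ → ℕ) :
    zeroLoopResult RC RP p m mem RP = p + m := by
  simp [zeroLoopResult, zeroLoopMem, hne.symm]

/-- One round of the zeroing body, computed. [folklore] -/
theorem execOps_zeroBody {w RC RP : ℕ} (hne : RC ≠ RP) {mem : ℕ → ℕ} {m p : ℕ}
    (hC : mem RC = m + 1) (hP : mem RP = p) (hpC : p ≠ RC) (hpP : p ≠ RP)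
    (hw : p + 1 < 2 ^ w) (hm : m + 1 < 2 ^ w) :
    execOps w mem (zeroBody RC RP) =
      Function.update (Function.update (Function.update mem p 0) RP (p + 1)) RC m := by
  simp only [zeroBody, execOps_cons, execOps_nil, execOp, Operand.write, Operand.read_imm,
    Operand.read_dir, BinOp.eval, hP]
  have e1 : (0 + 0) % 2 ^ w = 0 := by simp
  rw [e1]
  have hP1 : Function.update mem p 0 RP = p := by rw [Function.update_of_ne hpP.symm, hP]
  rw [hP1, Nat.mod_eq_of_lt hw]
  have hC2 : Function.update (Function.update mem p 0) RP (p + 1) RC = m + 1 := by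
    rw [Function.update_of_ne hne, Function.update_of_ne hpC.symm, hC]
  rw [hC2]
  congr 1
  rw [Nat.mod_eq_of_lt (by omega : 1 < 2 ^ w)]
  have : m + 1 + 2 ^ w - 1 = m + 2 ^ w := by omega
  rw [this, Nat.add_mod_right, Nat.mod_eq_of_lt (by omega)]

/-- **Semantics of the zeroing loop.** Placed at `pc = i₀`, with counter cell `RC` holding `m`,
pointer cell `RP` holding `p`, the two registers distinct and outside the segment `[p, p + m)`,
and `p + m < 2 ^ w`, the loop reaches `pc = i₀ + 5` after exactly `5 m + 1` steps with memory
`zeroLoopResult RC RP p m mem`, coins and query log unchanged. [folklore] -/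
theorem run_zeroLoop {P : Program} {w : ℕ} {O : List ℕ → List ℕ} {ρ : ℕ → ℕ} {i₀ RC RP : ℕ}
    (hne : RC ≠ RP) (hcode : CodeAt P i₀ (zeroLoop i₀ RC RP)) {m p : ℕ} {c : Cfg}
    (hpc : c.pc = some i₀) (hC : c.mem RC = m) (hP : c.mem RP = p)
    (hRC : RC < p ∨ p + m ≤ RC) (hRP : RP < p ∨ p + m ≤ RP) (hw : p + m < 2 ^ w) :
    run P w O ρ (5 * m + 1) c =
      some { c with pc := some (i₀ + 5), mem := zeroLoopResult RC RP p m c.mem } := by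
  -- invariant indexed by the remaining count `r`: `m - r` rounds are done
  let Inv : ℕ → (ℕ → ℕ) → Prop := fun r mem =>
    r ≤ m ∧ mem = zeroLoopMem RC RP p m (m - r) c.mem
  have hInvRC : ∀ r mem, Inv r mem → mem RC = r := by
    rintro r mem ⟨hr, rfl⟩
    simp only [zeroLoopMem, if_true]
    omega
  have hbody : ∀ r mem, Inv (r + 1) mem → Inv r (execOps w mem (zeroBody RC RP)) := by
    rintro r mem ⟨hr, rfl⟩
    refine ⟨by omega, ?_⟩
    obtain ⟨j, hj⟩ : ∃ j, m - (r + 1) = j := ⟨_, rfl⟩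
    have hjm : j + 1 ≤ m := by omega
    have hj' : m - r = j + 1 := by omega
    rw [hj, hj']
    have hpjC : p + j ≠ RC := by omega
    have hpjP : p + j ≠ RP := by omega
    rw [execOps_zeroBody hne (m := r) (p := p + j) ?_ ?_ hpjC hpjP (by omega) (by omega)]
    · funext a
      simp only [zeroLoopMem, Function.update_apply]
      by_cases h1 : a = RC
      · simp only [h1, if_true]; omega
      · simp only [h1, if_false]
        by_cases h2 : a = RP
        · simp only [h2, if_true]; omega
        · simp only [h2, if_false]
          by_cases h3 : a = p + j
          · subst h3
            simp only [if_true]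
            rw [if_pos (by omega)]
          · simp only [h3, if_false]
            by_cases h4 : p ≤ a ∧ a < p + j
            · rw [if_pos h4, if_pos (by omega)]
            · rw [if_neg h4, if_neg (by omega)]
    · simp only [zeroLoopMem, if_true]; omega
    · simp only [zeroLoopMem, hne.symm, if_false, if_true]
  have hInv0 : Inv m c.mem := by
    refine ⟨le_rfl, ?_⟩
    funext a
    simp only [zeroLoopMem, Nat.sub_self, Nat.add_zero]
    by_cases h1 : a = RC
    · simp [h1, hC]
    · simp only [h1, if_false]
      by_cases h2 : a = RP
      · simp [h2, hP]
      · simp only [h2, if_false]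
        rw [if_neg (by omega)]
  have hcode' : CodeAt P i₀ (loopBlock i₀ RC (zeroBody RC RP)) := hcode
  have hlen : (zeroBody RC RP).length = 3 := rfl
  have hrun := run_loop (P := P) (w := w) (O := O) (ρ := ρ) hInvRC hbody hcode' m hpc hInv0
  have hfin := loop_inv_iterate (w := w) hbody m c.mem hInv0
  obtain ⟨-, hfin⟩ := hfin
  rw [hlen] at hrun
  have hsteps : 5 * m + 1 = m * (3 + 2) + 1 := by omega
  rw [hsteps, hrun, hfin]
  simp only [Nat.sub_zero, Option.some.injEq]
  rfl

end Literature.Computability.Cryptography.WordRAM
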